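import Mathlib.MeasureTheory.Constructions.HaarToSphere
import Mathlib.MeasureTheory.Integral.Gamma
import Mathlib.Analysis.SpecialFunctions.Gaussian.GaussianIntegral
import Mathlib.MeasureTheory.Integral.Pi
import Mathlib.MeasureTheory.Measure.Haar.InnerProductSpace
import Literature.MathematicalPhysics.KineticTheory.TaggedSphereCollisionFrequency
import HarnessLib

/-!
# The total hard-sphere cross-section in three dimensions: `∫_{S²} (e·ω)₊ dω = π`

The Lorentz loss frequency `ν(v) = ∫_{S²} (v·ω)₊ dω` (`lorentzLossRate`, the total scattering rate of
the hard-sphere / Lorentz-gas collision kernels; its value is the cross-section of the unit ball swept at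
speed `|v|`, `ν(v) = |B^{d-1}| |v|`, Cercignani–Illner–Pulvirenti 1994 §3.1, Chapman–Cowling 1970 §3.6)
was known in the tree only up to its isotropy and homogeneity (`lorentzLossRate_eq_norm_mul`:
`ν(v) = |v| ν(e)` for any unit vector `e`). This file computes the constant in dimension three:

* `lorentzLossRate_eq_pi_mul_norm` — `ν(v) = π |v|` on `ℝ³` (`|B²| = π`), in particular
  `lorentzLossRate_eq_pi` for a unit vector;
* `integral_hardSphereKernel_eq_pi_mul_norm` — `∫_{S²} ((v − w)·ω)₊ dω = π |v − w|`, the constant that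
  every Enskog / Boltzmann collision-frequency functional on the hydrodynamic-limit board writes as the
  literal `Real.pi * ‖v - w‖`.

Proof (no surface parametrisation of `S²`): integrate `(e·x)₊ e^{-|x|²/2}` over `ℝ³` in two ways — in polar
coordinates (Mathlib's `measurePreserving_homeomorphUnitSphereProd`: Lebesgue measure on `ℝ³ ∖ {0}` is
`volume.toSphere ⊗ r² dr`) it is `ν(e) ∫₀^∞ r³ e^{-r²/2} dr = 2 ν(e)`
(`integral_posPart_inner_mul_exp_neg_sq`), and coordinatewise for `e = e₀` it is the product
`(∫ t₊ e^{-t²/2})(∫ e^{-t²/2})² = 1 · 2π` (`integral_posPart_coord_mul_exp_neg_sq`); isotropy moves `e₀` to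
any unit vector.

## Mathlib / Literature reuse

`MeasureTheory.Measure.toSphere`, `measurePreserving_homeomorphUnitSphereProd`, `Measure.volumeIoiPow`,
`integral_rpow_mul_exp_neg_mul_rpow` (Gamma integrals), `integral_gaussian`,
`integral_fintype_prod_volume_eq_prod`, `EuclideanSpace.volume_preserving_symm_measurableEquiv_toLp`;
the tree's `lorentzLossRate`, `lorentzLossRate_eq_norm_mul`, `lorentzLossRate_eq_of_norm_eq_one`,
`integral_hardSphereKernel`. Nothing is redefined.

## References

* C. Cercignani, R. Illner, M. Pulvirenti, *The Mathematical Theory of Dilute Gases*, Springer (1994),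
  §3.1 (hard-sphere cross-section).
* S. Chapman, T. G. Cowling, *The Mathematical Theory of Non-uniform Gases*, 3rd ed. (1970), §3.6, §16.
-/

open MeasureTheory Real Set Metric
open scoped InnerProductSpace ENNReal

noncomputable section

namespace Literature.MathematicalPhysics.KineticTheory

/-! ## Two one-dimensional Gaussian moments -/

/-- `∫₀^∞ r e^{-r²/2} dr = 1` (from Mathlib's Gamma integral, `Γ(1) = 1`). [folklore] -/
theorem integral_mul_exp_neg_sq_half :
    ∫ r in Ioi (0 : ℝ), r * rexp (-r ^ 2 / 2) = 1 := by
  have h := integral_rpow_mul_exp_neg_mul_rpow (p := 2) (q := 1) (b := 1 / 2) two_pos (by norm_num)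
    (by norm_num)
  have hl : ∫ x in Ioi (0 : ℝ), x ^ (1 : ℝ) * rexp (-(1 / 2) * x ^ (2 : ℝ)) =
      ∫ r in Ioi (0 : ℝ), r * rexp (-r ^ 2 / 2) := by
    refine setIntegral_congr_fun measurableSet_Ioi fun x _ => ?_
    rw [Real.rpow_one, Real.rpow_two]
    ring_nf
  rw [← hl, h, show (-(1 + 1) / 2 : ℝ) = -1 by norm_num, show ((1 + 1) / 2 : ℝ) = 1 by norm_num,
    Real.rpow_neg_one, Real.Gamma_one]
  norm_num

/-- `∫₀^∞ r³ e^{-r²/2} dr = 2` (from Mathlib's Gamma integral, `Γ(2) = 1`). [folklore] -/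
theorem integral_pow_three_mul_exp_neg_sq_half :
    ∫ r in Ioi (0 : ℝ), r ^ 3 * rexp (-r ^ 2 / 2) = 2 := by
  have h := integral_rpow_mul_exp_neg_mul_rpow (p := 2) (q := 3) (b := 1 / 2) two_pos (by norm_num)
    (by norm_num)
  have hl : ∫ x in Ioi (0 : ℝ), x ^ (3 : ℝ) * rexp (-(1 / 2) * x ^ (2 : ℝ)) =
      ∫ r in Ioi (0 : ℝ), r ^ 3 * rexp (-r ^ 2 / 2) := by
    refine setIntegral_congr_fun measurableSet_Ioi fun x _ => ?_
    rw [show (3 : ℝ) = ((3 : ℕ) : ℝ) by norm_num, Real.rpow_natCast, Real.rpow_two]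
    ring_nf
  rw [← hl, h, show (-(3 + 1) / 2 : ℝ) = -2 by norm_num, show ((3 + 1) / 2 : ℝ) = 2 by norm_num,
    Real.rpow_neg (by norm_num : (0 : ℝ) ≤ 1 / 2), Real.rpow_two, Real.Gamma_two]
  norm_num

/-! ## The Gaussian-weighted loss integral in polar coordinates -/

/-- A positive scalar comes out of the positive part: `(c a)₊ = c a₊` for `c ≥ 0`. [folklore] -/
theorem max_mul_zero_of_nonneg {c : ℝ} (hc : 0 ≤ c) (a : ℝ) : max (c * a) 0 = c * max a 0 := by
  rw [mul_max_of_nonneg _ _ hc, mul_zero]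

/-- **Polar coordinates**: `∫_{ℝ³} (v·x)₊ e^{-|x|²/2} dx = ν(v) · ∫₀^∞ r³ e^{-r²/2} dr`, where
`ν = lorentzLossRate` is the sphere integral `∫_{S²} (v·ω)₊ dω` against `volume.toSphere`
(Mathlib's polar decomposition `measurePreserving_homeomorphUnitSphereProd`). [folklore] -/
theorem integral_posPart_inner_mul_exp_neg_sq (v : (EuclideanSpace ℝ (Fin 3))) :
    ∫ x : (EuclideanSpace ℝ (Fin 3)), max ⟪v, x⟫_ℝ 0 * rexp (-‖x‖ ^ 2 / 2) =
      KineticTheory.lorentzLossRate v * ∫ r in Ioi (0 : ℝ), r ^ 3 * rexp (-r ^ 2 / 2) := by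
  set f : (EuclideanSpace ℝ (Fin 3)) → ℝ := fun x => max ⟪v, x⟫_ℝ 0 * rexp (-‖x‖ ^ 2 / 2) with hf
  set F : sphere (0 : (EuclideanSpace ℝ (Fin 3))) 1 × Ioi (0 : ℝ) → ℝ :=
    fun p => max ⟪v, (p.1 : (EuclideanSpace ℝ (Fin 3)))⟫_ℝ 0 * ((p.2 : ℝ) * rexp (-(p.2 : ℝ) ^ 2 / 2)) with hF
  have hdim : Module.finrank ℝ (EuclideanSpace ℝ (Fin 3)) - 1 = 2 := by rw [finrank_euclideanSpace_fin]
  have hmp := (volume : Measure (EuclideanSpace ℝ (Fin 3))).measurePreserving_homeomorphUnitSphereProd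
  rw [hdim] at hmp
  -- remove the origin
  have h1 : ∫ x, f x = ∫ x : ({(0 : (EuclideanSpace ℝ (Fin 3)))}ᶜ : Set (EuclideanSpace ℝ (Fin 3))), f x ∂(Measure.comap Subtype.val volume) := by
    rw [integral_subtype_comap (measurableSet_singleton _).compl f, restrict_compl_singleton]
  -- the integrand in polar coordinates
  have h2 : ∀ x : ({(0 : (EuclideanSpace ℝ (Fin 3)))}ᶜ : Set (EuclideanSpace ℝ (Fin 3))), f x = F (homeomorphUnitSphereProd (EuclideanSpace ℝ (Fin 3)) x) := by
    intro x
    have hx : (x : (EuclideanSpace ℝ (Fin 3))) ≠ 0 := x.2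
    have hn : ‖(x : (EuclideanSpace ℝ (Fin 3)))‖ ≠ 0 := norm_ne_zero_iff.2 hx
    simp only [hf, hF, homeomorphUnitSphereProd_apply_fst_coe, homeomorphUnitSphereProd_apply_snd_coe,
      inner_smul_right]
    rw [max_mul_zero_of_nonneg (inv_nonneg.2 (norm_nonneg _))]
    field_simp
  have h3 : ∫ x : ({(0 : (EuclideanSpace ℝ (Fin 3)))}ᶜ : Set (EuclideanSpace ℝ (Fin 3))), F (homeomorphUnitSphereProd (EuclideanSpace ℝ (Fin 3)) x) ∂(Measure.comap Subtype.val volume)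
      = ∫ p, F p ∂((volume : Measure (EuclideanSpace ℝ (Fin 3))).toSphere.prod (Measure.volumeIoiPow 2)) :=
    hmp.integral_comp (Homeomorph.measurableEmbedding _) F
  have h4 : ∫ p, F p ∂((volume : Measure (EuclideanSpace ℝ (Fin 3))).toSphere.prod (Measure.volumeIoiPow 2))
      = (∫ ω, max ⟪v, ((ω : sphere (0 : (EuclideanSpace ℝ (Fin 3))) 1) : (EuclideanSpace ℝ (Fin 3)))⟫_ℝ 0 ∂(volume : Measure (EuclideanSpace ℝ (Fin 3))).toSphere) *
        ∫ r, ((r : Ioi (0 : ℝ)) : ℝ) * rexp (-((r : Ioi (0 : ℝ)) : ℝ) ^ 2 / 2) ∂(Measure.volumeIoiPow 2) :=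
    integral_prod_mul (μ := (volume : Measure (EuclideanSpace ℝ (Fin 3))).toSphere) (ν := Measure.volumeIoiPow 2)
      (fun ω : sphere (0 : (EuclideanSpace ℝ (Fin 3))) 1 => max ⟪v, (ω : (EuclideanSpace ℝ (Fin 3)))⟫_ℝ 0)
      (fun r : Ioi (0 : ℝ) => (r : ℝ) * rexp (-(r : ℝ) ^ 2 / 2))
  have h5 : ∫ r, ((r : Ioi (0 : ℝ)) : ℝ) * rexp (-((r : Ioi (0 : ℝ)) : ℝ) ^ 2 / 2) ∂(Measure.volumeIoiPow 2)
      = ∫ r in Ioi (0 : ℝ), r ^ 3 * rexp (-r ^ 2 / 2) := by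
    simp only [Measure.volumeIoiPow, ENNReal.ofReal]
    rw [integral_withDensity_eq_integral_smul (measurable_subtype_coe.pow_const _).real_toNNReal,
      integral_subtype_comap measurableSet_Ioi
        (fun a : ℝ => Real.toNNReal (a ^ 2) • (a * rexp (-a ^ 2 / 2)))]
    refine setIntegral_congr_fun measurableSet_Ioi fun x hx => ?_
    rw [NNReal.smul_def, Real.coe_toNNReal _ (pow_nonneg hx.out.le _), smul_eq_mul]
    ring
  rw [h1, integral_congr_ae (Filter.Eventually.of_forall h2), h3, h4, h5]
  rfl

/-! ## The same integral coordinatewise, for the first basis vector -/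

/-- `∫_ℝ t₊ e^{-t²/2} dt = 1`. [folklore] -/
theorem integral_posPart_mul_exp_neg_sq_half :
    ∫ t : ℝ, max t 0 * rexp (-t ^ 2 / 2) = 1 := by
  rw [← setIntegral_eq_integral_of_forall_compl_eq_zero (s := Ioi (0 : ℝ))
    (fun t ht => by rw [max_eq_right (not_lt.1 ht), zero_mul])]
  rw [setIntegral_congr_fun measurableSet_Ioi (fun t (ht : 0 < t) => by rw [max_eq_left ht.le]),
    integral_mul_exp_neg_sq_half]

/-- `∫_ℝ e^{-t²/2} dt = √(2π)` (Mathlib's `integral_gaussian`). [folklore] -/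
theorem integral_exp_neg_sq_half : ∫ t : ℝ, rexp (-t ^ 2 / 2) = √(2 * π) := by
  have h := integral_gaussian (1 / 2)
  rw [show π / (1 / 2) = 2 * π by ring] at h
  rw [← h]
  exact integral_congr_ae (Filter.Eventually.of_forall fun t => by simp only; ring_nf)

/-- **Coordinatewise**: for the basis vector `e₀`, `∫_{ℝ³} (e₀·x)₊ e^{-|x|²/2} dx = 2π` (Fubini on
`ℝ³ ≃ ℝ × ℝ × ℝ`, `EuclideanSpace.volume_preserving_symm_measurableEquiv_toLp`). [folklore] -/
theorem integral_posPart_coord_mul_exp_neg_sq :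
    ∫ x : (EuclideanSpace ℝ (Fin 3)), max ⟪EuclideanSpace.single (0 : Fin 3) (1 : ℝ), x⟫_ℝ 0 * rexp (-‖x‖ ^ 2 / 2) = 2 * π := by
  have hmp := EuclideanSpace.volume_preserving_symm_measurableEquiv_toLp (Fin 3)
  set h : Fin 3 → ℝ → ℝ :=
    ![fun t => max t 0 * rexp (-t ^ 2 / 2), fun t => rexp (-t ^ 2 / 2), fun t => rexp (-t ^ 2 / 2)] with hh
  set g : (Fin 3 → ℝ) → ℝ := fun y => ∏ i, h i (y i) with hg
  have hfg : ∀ x : (EuclideanSpace ℝ (Fin 3)), max ⟪EuclideanSpace.single (0 : Fin 3) (1 : ℝ), x⟫_ℝ 0 * rexp (-‖x‖ ^ 2 / 2)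
      = g ((MeasurableEquiv.toLp 2 (Fin 3 → ℝ)).symm x) := by
    intro x
    simp only [hg, MeasurableEquiv.toLp_symm_apply, EuclideanSpace.inner_single_left, map_one, one_mul,
      EuclideanSpace.norm_sq_eq, Real.norm_eq_abs, sq_abs, Fin.prod_univ_three, Fin.sum_univ_three, hh,
      Matrix.cons_val_zero, Matrix.cons_val_one, Matrix.cons_val_two, Matrix.tail_cons, Matrix.head_cons]
    have hexp : rexp (-(x.ofLp 0 ^ 2 + x.ofLp 1 ^ 2 + x.ofLp 2 ^ 2) / 2) =
        rexp (-x.ofLp 0 ^ 2 / 2) * rexp (-x.ofLp 1 ^ 2 / 2) * rexp (-x.ofLp 2 ^ 2 / 2) := by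
      rw [← Real.exp_add, ← Real.exp_add]
      congr 1
      ring
    rw [hexp]
    ring
  simp_rw [hfg]
  rw [hmp.integral_comp' g]
  simp only [hg]
  rw [integral_fintype_prod_volume_eq_prod, Fin.prod_univ_three]
  simp only [hh, Matrix.cons_val_zero, Matrix.cons_val_one, Matrix.cons_val_two, Matrix.tail_cons,
    Matrix.head_cons, integral_posPart_mul_exp_neg_sq_half, integral_exp_neg_sq_half, one_mul]
  exact Real.mul_self_sqrt (by positivity)

/-! ## The constant -/

/-- **`ν(e₀) = π`** for the first basis vector of `ℝ³`. [folklore] -/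
theorem lorentzLossRate_single :
    KineticTheory.lorentzLossRate (EuclideanSpace.single (0 : Fin 3) (1 : ℝ)) = π := by
  have h := integral_posPart_inner_mul_exp_neg_sq (EuclideanSpace.single (0 : Fin 3) (1 : ℝ))
  rw [integral_posPart_coord_mul_exp_neg_sq, integral_pow_three_mul_exp_neg_sq_half] at h
  linarith

/-- **The total hard-sphere cross-section in `ℝ³`**: `∫_{S²} (e·ω)₊ dω = π = |B²|` for every unit
vector `e` (CIP 1994 §3.1). [cite: CIP1994, §3.1] -/
theorem lorentzLossRate_eq_pi {e : (EuclideanSpace ℝ (Fin 3))} (he : ‖e‖ = 1) : KineticTheory.lorentzLossRate e = π := by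
  rw [lorentzLossRate_eq_of_norm_eq_one he (e' := EuclideanSpace.single (0 : Fin 3) (1 : ℝ)) (by simp),
    lorentzLossRate_single]

/-- **`ν(v) = π |v|` on `ℝ³`**: the loss frequency of the hard-sphere kernel is `π` times the speed
(CIP 1994 §3.1; Chapman–Cowling §3.6). [cite: CIP1994, §3.1] -/
theorem lorentzLossRate_eq_pi_mul_norm (v : (EuclideanSpace ℝ (Fin 3))) : KineticTheory.lorentzLossRate v = π * ‖v‖ := by
  rw [lorentzLossRate_eq_norm_mul (e := EuclideanSpace.single (0 : Fin 3) (1 : ℝ)) (by simp) v,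
    lorentzLossRate_single, mul_comm]

/-- **`∫_{S²} ((v − w)·ω)₊ dω = π |v − w|`**: the sphere integral of the hard-sphere kernel in three
dimensions (the literal `Real.pi * ‖v - w‖` of the Enskog collision-frequency functionals).
[cite: CIP1994, §3.1] -/
theorem integral_hardSphereKernel_eq_pi_mul_norm (v w : (EuclideanSpace ℝ (Fin 3))) :
    ∫ ω, hardSphereKernel (v, w) ω ∂sphereMeasure = π * ‖v - w‖ := by
  rw [integral_hardSphereKernel, lorentzLossRate_eq_pi_mul_norm]

end Literature.MathematicalPhysics.KineticTheory

end
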